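import Literature.NumberTheory.DiophantineGeometry.SuperellipticHeights
import Literature.NumberTheory.DiophantineGeometry.SuperellipticHeightsLocal
import Literature.NumberTheory.DiophantineGeometry.SuperellipticHeightsLocalArch
import HarnessLib

/-!
# Weil height of the noncritical coordinate `t = 1/r + r^{m'}/s` on `r^e = x(1-x)`

[GenEll] = S. Mochizuki, *Arithmetic elliptic curves in general position*, Math. J. Okayama Univ. 52
(2010); abc-iut cell, route item `Summit.ABC.ABC.Theses.IUTThetaPilot.GenEllTwo`, S6's
number-field-only plan GENELLTWO-P1ROUTE §2(B)/§3(b), work package W4a. On `D_e : r^e = x(1-x)`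
(`e ≥ 2`, `e + 1 = 2m'`, `s = 1 - 2x`) the noncritical coordinate

  `t := 1/r + r^{m'}/s`

has simple poles over `x ∈ {0,1,∞}` and at `s = 0`, and `e·(t)_∞ ∼ (e+3)·(x)_∞`, so
`e·h(t(P)) = (e+3)·h(x(P)) + O(1)` ([GenEll] Prop. 1.4 (i), (iii) for `t, x : D_e → ℙ¹`). PROVED here,
convention-free on elements of a number field `K`:

* `exists_abs_logHeight₁_tPart_sub_le` — `t₂ := r^{m'}/s`: `|e·h_K(t₂) − (e+1)·h_K(x)| ≤ C·[K:ℚ]`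
  (place-by-place, `SuperellipticHeightsLocal(Arch)` + the two-sided local-to-global principle);
* `exists_abs_logHeight₁_tFun_sub_le` — **`|e·h_K(1/r + r^{m'}/(1-2x)) − (e+3)·h_K(x)| ≤ C·[K:ℚ]`**
  for `r^e = x(1-x)`, `x ∉ {0, 1, 1/2}`: `t₁ = 1/r` has `e·h(t₁) = 2·h(x) + O(1)`
  (`Superelliptic.exists_abs_logHeight₁_root_sub_le`), the polar parts of `t₁, t₂` are disjoint so
  `h(t₁ + t₂) = h(t₁) + h(t₂) + O(1)` (`tSum_lower(_of_isNonarchimedean)` and Mathlib's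
  `logHeight₁_add_le`).

Constants depend on `e` only. Everything is proved; no definitions, no named facts; classical height
theory — nothing here refers to the disputed parts of the abc-iut corpus.
-/

noncomputable section

open Height Height.AdmissibleAbsValues Finset Real NumberField
open Literature.NumberTheory.Transcendental

namespace Literature.NumberTheory.DiophantineGeometry

namespace Superelliptic

section NumberField

variable {K : Type*} [Field K] [NumberField K]

/-- `h_K(n) ≤ [K:ℚ]·log n` for a natural number `n ≥ 1` (logarithmic form of the tree's
`Transcendental.mulHeight₁_natCast_le`). [folklore] -/
private theorem logHeight₁_natCast_le (n : ℕ) (hn : n ≠ 0) :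
    logHeight₁ (n : K) ≤ Module.finrank ℚ K * Real.log n := by
  have h := mulHeight₁_natCast_le (K := K) n hn
  have hlog := Real.log_le_log (mulHeight₁_pos _) h
  rw [Real.log_pow, totalWeight_eq_finrank] at hlog
  exact hlog

/-- `|h_K(1 - 2x) − h_K(x)| ≤ 2·log 2·[K:ℚ]`. [folklore] -/
private theorem abs_logHeight₁_s_sub_le (x : K) :
    |logHeight₁ (1 - 2 * x) - logHeight₁ x| ≤ 2 * Real.log 2 * Module.finrank ℚ K := by
  have h2 : logHeight₁ (2 : K) ≤ Module.finrank ℚ K * Real.log 2 := by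
    simpa using logHeight₁_natCast_le (K := K) 2 two_ne_zero
  have hup : logHeight₁ (1 - 2 * x) ≤ 2 * Real.log 2 * Module.finrank ℚ K + logHeight₁ x := by
    have h1 := logHeight₁_sub_le (1 : K) (2 * x)
    have h3 := logHeight₁_mul_le (2 : K) x
    rw [logHeight₁_one, totalWeight_eq_finrank] at h1
    linarith
  have hdown : logHeight₁ x ≤ 2 * Real.log 2 * Module.finrank ℚ K + logHeight₁ (1 - 2 * x) := by
    have e1 : x = (1 - (1 - 2 * x)) * (2 : K)⁻¹ := by
      have : (2 : K) ≠ 0 := two_ne_zero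
      field_simp; ring
    have h1 := logHeight₁_sub_le (1 : K) (1 - 2 * x)
    have h3 := logHeight₁_mul_le (1 - (1 - 2 * x)) (2 : K)⁻¹
    rw [logHeight₁_one, totalWeight_eq_finrank] at h1
    rw [logHeight₁_inv] at h3
    rw [← e1] at h3
    linarith
  rw [abs_le]; constructor <;> linarith

/-- **`|e·h_K(r^{m'}/(1-2x)) − (e+1)·h_K(x)| ≤ C·[K:ℚ]`** for `r^e = x(1-x)`, `1 - 2x ≠ 0`,
`e ≥ 1`, `e + 1 = 2m'`, with `C` depending only on `e` (the function `t₂ = r^{m'}/s` on `D_e` has polar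
divisor `Q_∞ + Σ W_k`, and `e·(t₂)_∞ = (x)_∞ + e·(s)_0`; [GenEll] Prop. 1.4 (i)).
[cite: MochizukiGenEll2010, Prop 1.4 (i) p.6] -/
theorem exists_abs_logHeight₁_tPart_sub_le {e m' : ℕ} (he : 0 < e) (hem : e + 1 = 2 * m') :
    ∃ C : ℝ, ∀ (K : Type) [Field K] [NumberField K] (x r : K), r ^ e = x * (1 - x) →
      1 - 2 * x ≠ 0 →
      |(e : ℝ) * logHeight₁ (r ^ m' / (1 - 2 * x)) - (e + 1) * logHeight₁ x| ≤ C * Module.finrank ℚ K := by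
  refine ⟨e * Real.log 4 + e * Real.log 2 + 2 * e * Real.log 2 + e * Real.log 24, ?_⟩
  intro K _ _ x r hr hs
  have h2 : (2 : K) ≠ 0 := two_ne_zero
  set s := 1 - 2 * x with hsdef
  set t₂ := r ^ m' / s with ht₂
  have htw : (totalWeight K : ℝ) = Module.finrank ℚ K := by rw [totalWeight_eq_finrank]
  have hK0 : (0 : ℝ) ≤ Module.finrank ℚ K := Nat.cast_nonneg _
  -- heights of the auxiliary constants
  have h2h : logHeight₁ (2 : K)⁻¹ ≤ Module.finrank ℚ K * Real.log 2 := by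
    rw [logHeight₁_inv]; simpa using logHeight₁_natCast_le (K := K) 2 two_ne_zero
  have hsinv : logHeight₁ s⁻¹ = logHeight₁ s := logHeight₁_inv _
  have hsx := abs_logHeight₁_s_sub_le x
  rw [abs_le] at hsx
  -- upper bound via the two-sided local-to-global principle
  have hup : mulHeight₁ t₂ ^ e ≤ ((4 : ℝ) ^ e) ^ totalWeight K *
      (mulHeight₁ (2 : K)⁻¹ ^ e * mulHeight₁ x * mulHeight₁ s⁻¹ ^ e) := by
    have h := mulHeight₁_prod_le_prod_of_forall_absValue (K := K) (univ : Finset (Fin 1))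
      (univ : Finset (Fin 3)) (x := ![t₂]) (e := ![e]) (y := ![(2 : K)⁻¹, x, s⁻¹]) (a := ![e, 1, e])
      (C := (4 : ℝ) ^ e) (fun v _ => ?_) (fun v hv => ?_)
    · simpa only [Fin.prod_univ_succ, Fin.prod_univ_zero, Matrix.cons_val_zero, Matrix.cons_val_succ,
        mul_one, pow_one, mul_assoc] using h
    · simp only [Fin.prod_univ_succ, Fin.prod_univ_zero, Matrix.cons_val_zero, Matrix.cons_val_succ,
        mul_one, pow_one]
      have := tPart_upper v hem h2 hr hs
      simpa only [mul_assoc] using this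
    · simp only [Fin.prod_univ_succ, Fin.prod_univ_zero, Matrix.cons_val_zero, Matrix.cons_val_succ,
        mul_one, pow_one]
      have := tPart_upper_of_isNonarchimedean v (isNonarchimedean v hv) hem h2 hr hs
      simpa only [mul_assoc] using this
  -- lower bound
  have hlow : mulHeight₁ x * mulHeight₁ s⁻¹ ^ e ≤ ((24 : ℝ) ^ e) ^ totalWeight K * mulHeight₁ t₂ ^ e := by
    have h := mulHeight₁_prod_le_prod_of_forall_absValue (K := K) (univ : Finset (Fin 2))
      (univ : Finset (Fin 1)) (x := ![x, s⁻¹]) (e := ![1, e]) (y := ![t₂]) (a := ![e])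
      (C := (24 : ℝ) ^ e) (fun v _ => ?_) (fun v hv => ?_)
    · simpa only [Fin.prod_univ_succ, Fin.prod_univ_zero, Matrix.cons_val_zero, Matrix.cons_val_succ,
        mul_one, pow_one] using h
    · simp only [Fin.prod_univ_succ, Fin.prod_univ_zero, Matrix.cons_val_zero, Matrix.cons_val_succ,
        mul_one, pow_one]
      exact tPart_lower v hem he hr hs
    · simp only [Fin.prod_univ_succ, Fin.prod_univ_zero, Matrix.cons_val_zero, Matrix.cons_val_succ,
        mul_one, pow_one]
      exact tPart_lower_of_isNonarchimedean v (isNonarchimedean v hv) hem h2 hr hs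
  -- logarithms
  have hposT := mulHeight₁_pos t₂
  have hposX := mulHeight₁_pos x
  have hposS := mulHeight₁_pos s⁻¹
  have hpos2 := mulHeight₁_pos (2 : K)⁻¹
  have hup' : (e : ℝ) * logHeight₁ t₂ ≤ totalWeight K * (e * Real.log 4) +
      (e * logHeight₁ (2 : K)⁻¹ + logHeight₁ x + e * logHeight₁ s⁻¹) := by
    have hlog := Real.log_le_log (by positivity) hup
    rw [Real.log_pow, Real.log_mul (by positivity) (by positivity), Real.log_pow, Real.log_pow,
      Real.log_mul (by positivity) (by positivity), Real.log_mul (by positivity) (by positivity),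
      Real.log_pow, Real.log_pow] at hlog
    simp only [logHeight₁_eq_log_mulHeight₁]
    linarith
  have hlow' : logHeight₁ x + e * logHeight₁ s⁻¹ ≤ totalWeight K * (e * Real.log 24) + e * logHeight₁ t₂ := by
    have hlog := Real.log_le_log (by positivity) hlow
    rw [Real.log_mul (by positivity) (by positivity), Real.log_pow, Real.log_mul (by positivity)
      (by positivity), Real.log_pow, Real.log_pow, Real.log_pow] at hlog
    simp only [logHeight₁_eq_log_mulHeight₁]
    linarith
  rw [htw] at hup' hlow'
  rw [hsinv] at hup' hlow'
  rw [← hsdef] at hsx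
  have he0 : (0 : ℝ) ≤ e := Nat.cast_nonneg _
  set n : ℝ := (Module.finrank ℚ K : ℝ) with hn
  have hS1 : (e : ℝ) * logHeight₁ s ≤ e * (logHeight₁ x + 2 * Real.log 2 * n) :=
    mul_le_mul_of_nonneg_left (by linarith [hsx.2]) he0
  have hS2 : (e : ℝ) * logHeight₁ x ≤ e * (logHeight₁ s + 2 * Real.log 2 * n) :=
    mul_le_mul_of_nonneg_left (by linarith [hsx.1]) he0
  have hD : (e : ℝ) * logHeight₁ (2 : K)⁻¹ ≤ e * (n * Real.log 2) := mul_le_mul_of_nonneg_left h2h he0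
  have hl2 : 0 ≤ Real.log 2 := Real.log_nonneg (by norm_num)
  have hl4 : 0 ≤ Real.log 4 := Real.log_nonneg (by norm_num)
  have hl24 : 0 ≤ Real.log 24 := Real.log_nonneg (by norm_num)
  have hp1 : 0 ≤ (e : ℝ) * Real.log 4 * n := by positivity
  have hp2 : 0 ≤ (e : ℝ) * Real.log 2 * n := by positivity
  have hp3 : 0 ≤ (e : ℝ) * Real.log 24 * n := by positivity
  rw [abs_le]
  constructor
  · linarith
  · linarith

/-- **`|e·h_K(1/r + r^{m'}/(1-2x)) − (e+3)·h_K(x)| ≤ C·[K:ℚ]`** for every number field `K` and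
`x, r ∈ K` with `r^e = x(1-x)`, `x ≠ 0`, `x ≠ 1`, `1 - 2x ≠ 0` (`e ≥ 2`, `e + 1 = 2m'`), with `C`
depending only on `e`: the Weil height of the noncritical coordinate `t = 1/r + r^{m'}/s` of the plan
GENELLTWO-P1ROUTE §2(B) compares with `h(x)` with the sharp slope `(e+3)/e` — [GenEll] Prop. 1.4
(i), (iii) for `t, x : D_e → ℙ¹` (`e·(t)_∞ ∼ (e+3)·(x)_∞`). [cite: MochizukiGenEll2010, Prop 1.4 (i) p.6] -/
theorem exists_abs_logHeight₁_tFun_sub_le {e m' : ℕ} (he : 2 ≤ e) (hem : e + 1 = 2 * m') :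
    ∃ C : ℝ, ∀ (K : Type) [Field K] [NumberField K] (x r : K), r ^ e = x * (1 - x) →
      x ≠ 0 → x ≠ 1 → 1 - 2 * x ≠ 0 →
      |(e : ℝ) * logHeight₁ (r⁻¹ + r ^ m' / (1 - 2 * x)) - (e + 3) * logHeight₁ x| ≤
        C * Module.finrank ℚ K := by
  have he0 : 0 < e := by omega
  obtain ⟨C₁, hC₁⟩ := exists_abs_logHeight₁_root_sub_le he0
  obtain ⟨C₂, hC₂⟩ := exists_abs_logHeight₁_tPart_sub_le he0 hem
  refine ⟨C₁ + C₂ + e * Real.log 32 + e * Real.log 2, ?_⟩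
  intro K _ _ x r hr hx0 hx1 hs
  have h2 : (2 : K) ≠ 0 := two_ne_zero
  have hr0 : r ≠ 0 := by
    intro h
    rw [h, zero_pow he0.ne'] at hr
    exact mul_ne_zero hx0 (sub_ne_zero.mpr (Ne.symm hx1)) hr.symm
  set t₁ := r⁻¹ with ht₁
  set t₂ := r ^ m' / (1 - 2 * x) with ht₂
  have htw : (totalWeight K : ℝ) = Module.finrank ℚ K := by rw [totalWeight_eq_finrank]
  have hK0 : (0 : ℝ) ≤ Module.finrank ℚ K := Nat.cast_nonneg _
  have heR : (0 : ℝ) ≤ e := Nat.cast_nonneg _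
  -- `h(t₁) = h(r)` and the two instances
  have ht₁h : logHeight₁ t₁ = logHeight₁ r := logHeight₁_inv r
  have h1 := hC₁ K x r hr
  have h2' := hC₂ K x r hr hs
  rw [abs_le] at h1 h2'
  -- additivity, lower: `H(t₁)·H(t₂) ≤ 32^{tw}·H(t₁+t₂)`
  have hadd : mulHeight₁ t₁ * mulHeight₁ t₂ ≤ (32 : ℝ) ^ totalWeight K * mulHeight₁ (t₁ + t₂) := by
    have h := mulHeight₁_prod_le_prod_of_forall_absValue (K := K) (univ : Finset (Fin 2))
      (univ : Finset (Fin 1)) (x := ![t₁, t₂]) (e := ![1, 1]) (y := ![t₁ + t₂]) (a := ![1])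
      (C := (32 : ℝ)) (fun v _ => ?_) (fun v hv => ?_)
    · simpa only [Fin.prod_univ_succ, Fin.prod_univ_zero, Matrix.cons_val_zero, Matrix.cons_val_succ,
        mul_one, pow_one] using h
    · simp only [Fin.prod_univ_succ, Fin.prod_univ_zero, Matrix.cons_val_zero, Matrix.cons_val_succ,
        mul_one, pow_one]
      exact tSum_lower v hem he hr hr0 hs
    · simp only [Fin.prod_univ_succ, Fin.prod_univ_zero, Matrix.cons_val_zero, Matrix.cons_val_succ,
        mul_one, pow_one]
      exact tSum_lower_of_isNonarchimedean v (isNonarchimedean v hv) hem he0 hr hr0 hs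
  have haddlog : logHeight₁ t₁ + logHeight₁ t₂ ≤ Module.finrank ℚ K * Real.log 32 + logHeight₁ (t₁ + t₂) := by
    have hlog := Real.log_le_log (mul_pos (mulHeight₁_pos _) (mulHeight₁_pos _)) hadd
    rw [Real.log_mul (mulHeight₁_pos _).ne' (mulHeight₁_pos _).ne', Real.log_mul (by positivity)
      (mulHeight₁_pos _).ne', Real.log_pow, htw] at hlog
    simp only [logHeight₁_eq_log_mulHeight₁]
    linarith
  -- additivity, upper
  have haddup : logHeight₁ (t₁ + t₂) ≤ Module.finrank ℚ K * Real.log 2 + logHeight₁ t₁ + logHeight₁ t₂ := by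
    have h := logHeight₁_add_le t₁ t₂
    rwa [htw] at h
  rw [ht₁h] at haddlog haddup
  have hm1 := mul_le_mul_of_nonneg_left haddlog heR
  have hm2 := mul_le_mul_of_nonneg_left haddup heR
  have hl2 : 0 ≤ Real.log 2 := Real.log_nonneg (by norm_num)
  have hl32 : 0 ≤ Real.log 32 := Real.log_nonneg (by norm_num)
  have hp1 : 0 ≤ (e : ℝ) * Real.log 2 * Module.finrank ℚ K := by positivity
  have hp2 : 0 ≤ (e : ℝ) * Real.log 32 * Module.finrank ℚ K := by positivity
  rw [abs_le]
  constructor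
  · linarith [h1.1, h1.2, h2'.1, h2'.2]
  · linarith [h1.1, h1.2, h2'.1, h2'.2]

end NumberField

end Superelliptic

end Literature.NumberTheory.DiophantineGeometry

end
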